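import Literature.MathematicalPhysics.QuantumLattice.LatticeGaugeDLR
import Summits.Ventures.YMGap.Thresholds.LatticeCorners

/-!
# Venture YMGap — Theorem C on `ℤ^d` with frozen exterior: the Hessian of the REGIONAL Wilson sum
# (all plaquettes touching a finite edge set, arbitrary exterior links) is at most `4d ‖X‖²`

HONEST FRAMING: venture file (cell `pub-ymgap`, track (a), item A2, uniqueness leg). Theorem C of
`p2/HESSIAN-SHARP.md` was kernel-checked on the torus `(ℤ/L)^d` (`HessianSharp.hessianForm_le_four_d`,
`WilsonHessian.abs_second_variation_le_four_d`). The Bakry–Émery criterion for the DLR KERNELS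
`γ_E(· | η)` of the Wilson specification on `ℤ^d` (finite edge set `E`, exterior configuration `η`
frozen) needs the same bound for the regional potential `Σ_{p ∩ E ≠ ∅} Re tr hol_p` on `SU(N)^E`:
for every configuration `Q` on `ℤ^d`, every perturbation `X` supported on `E`,
`|Σ_{p ∩ E ≠ ∅} plaqHess_p(Q,X)| ≤ 4d Σ_{e∈E} ‖X_e‖²` (`abs_regionHess_le_four_d`; the calculus
identification with `d²/dt²|₀ Σ_{p ∩ E ≠ ∅} Re tr hol_p(e^{tX}Q)` is the sibling file
`RegionHessianCalculus`). The proof is the four-square SOS proof of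
`p2/SPL-SOS.md` §3, which is LOCAL: one plaquette is bounded by its four corner terms
(`zplaqHess_le_corners`, the `ℤ^d` copy of `LatticeCorners.plaqHess_le_corners`), corners are
re-indexed injectively by (vertex, direction pair) into a finite vertex set (`sum_corners_le_verts`),
at a vertex orthogonal pairs are bounded by `2d Σ_a ‖X̂_a(v)‖²` (`LatticeCorners.sum_orthPairs_le`),
and every edge has two ends (`sum_zendVec_sq_le`). No measure, threshold or uniqueness statement is
made in this file.

Reference: cell files `p2/SPL-SOS.md` §3, `p2/HESSIAN-SHARP.md` §3; H. Shen, R. Zhu, X. Zhu,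
CMP 400 (2023) 805, Lemma 4.1 and Remark 1.3 (boundary conditions).
-/

noncomputable section

namespace Summit.Ventures.YMGap.HessianSharp

open Matrix Complex NormedSpace Finset
open Literature.MathematicalPhysics.QuantumLattice
open Literature.Probability.LatticeModels (Site)
open scoped Matrix ComplexConjugate BigOperators

variable {n : Type*} [Fintype n] [DecidableEq n] {d : ℕ}

/-! ## Lattice objects on `ℤ^d` -/

/-- The Hessian form of the plaquette `(x; i, j)` of `ℤ^d` (links `Q₁ = Q(x,i)`, `Q₂ = Q(x+eᵢ,j)`,
`Q₃ = Q(x+eⱼ,i)`, `Q₄ = Q(x,j)`, word `Q₁Q₂Q₃ᴴQ₄ᴴ` as in `plaquetteHolonomyZd`): `word2` with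
`V = (X₁, X₂, -X₃, -X₄)`, `B = (Q₁, Q₂Q₃ᴴ, Q₄ᴴ, 1)` — the `ℤ^d` copy of `LatticeCorners.plaqHess`. -/
def zplaqHess (Q X : LGConfig d (Matrix n n ℂ)) (x : Site d) (i j : Fin d) : ℝ :=
  word2 (X (x, i)) (Q (x, i)) (X (x + Pi.single i 1, j))
    (Q (x + Pi.single i 1, j) * (Q (x + Pi.single j 1, i))ᴴ)
    (-X (x + Pi.single j 1, i)) (Q (x, j))ᴴ (-X (x, j)) 1

/-- Edge-end vectors at a site of `ℤ^d` (`X̂_e(v)`): the edge `(v,i)` starts at `v` and contributes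
`X(v,i)`; the edge `(v - eᵢ, i)` ends at `v` and contributes `-Q_eᴴ X_e Q_e`. -/
def zendVec (Q X : LGConfig d (Matrix n n ℂ)) (v : Site d) : Fin d × Bool → Matrix n n ℂ
  | (i, false) => X (v, i)
  | (i, true) => -((Q (v - Pi.single i 1, i))ᴴ * X (v - Pi.single i 1, i) * Q (v - Pi.single i 1, i))

/-- The corner term `‖X̂_a(v) − X̂_b(v)‖²` at a site of `ℤ^d`. -/
def zcornerSq (Q X : LGConfig d (Matrix n n ℂ)) (v : Site d) (a b : Fin d × Bool) : ℝ :=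
  frobSq (zendVec Q X v a - zendVec Q X v b)

/-- The four corner terms at `v` of the direction pair `(i, j)` (both start; `j` starts/`i` ends;
both end; `i` starts/`j` ends). -/
def zsiteCorner (Q X : LGConfig d (Matrix n n ℂ)) (v : Site d) (i j : Fin d) : ℝ :=
  zcornerSq Q X v (i, false) (j, false) + zcornerSq Q X v (j, false) (i, true)
    + zcornerSq Q X v (j, true) (i, true) + zcornerSq Q X v (i, false) (j, true)

omit [DecidableEq n] in
/-- Corner terms are nonnegative. -/
theorem zcornerSq_nonneg (Q X : LGConfig d (Matrix n n ℂ)) (v : Site d) (a b : Fin d × Bool) :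
    0 ≤ zcornerSq Q X v a b :=
  frobSq_nonneg _

omit [DecidableEq n] in
/-- Unfolding `zendVec` at a forward end. -/
theorem zendVec_false (Q X : LGConfig d (Matrix n n ℂ)) (v : Site d) (i : Fin d) :
    zendVec Q X v (i, false) = X (v, i) := rfl

omit [DecidableEq n] in
/-- Unfolding `zendVec` at a backward end. -/
theorem zendVec_true (Q X : LGConfig d (Matrix n n ℂ)) (v : Site d) (i : Fin d) :
    zendVec Q X v (i, true) =
      -((Q (v - Pi.single i 1, i))ᴴ * X (v - Pi.single i 1, i) * Q (v - Pi.single i 1, i)) := rfl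

omit [DecidableEq n] in
/-- The backward end of the edge `(x, i)` sits at `x + eᵢ`. -/
theorem zendVec_add_true (Q X : LGConfig d (Matrix n n ℂ)) (x : Site d) (i : Fin d) :
    zendVec Q X (x + Pi.single i 1) (i, true) = -((Q (x, i))ᴴ * X (x, i) * Q (x, i)) := by
  simp only [zendVec_true, add_sub_cancel_right]

omit [DecidableEq n] in
/-- The backward end of the edge `(x + eⱼ, i)` sits at `x + eᵢ + eⱼ`. -/
theorem zendVec_add_add_true (Q X : LGConfig d (Matrix n n ℂ)) (x : Site d) (i j : Fin d) :
    zendVec Q X (x + Pi.single i 1 + Pi.single j 1) (i, true) =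
      -((Q (x + Pi.single j 1, i))ᴴ * X (x + Pi.single j 1, i) * Q (x + Pi.single j 1, i)) := by
  rw [add_right_comm, zendVec_add_true]

/-! ## Step A on `ℤ^d`: one plaquette is bounded by its four corners (two-sided) -/

/-- **SPL on `ℤ^d`.** For unitary links, the Hessian form of the plaquette `(x; i, j)` is at most
the sum of its four corner terms (at `x`, `x+eᵢ`, `x+eᵢ+eⱼ`, `x+eⱼ`). -/
theorem zplaqHess_le_corners (Q X : LGConfig d (Matrix n n ℂ))
    (hQ : ∀ e, Q e ∈ Matrix.unitaryGroup n ℂ) (x : Site d) (i j : Fin d) :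
    zplaqHess Q X x i j ≤
      zcornerSq Q X x (i, false) (j, false)
      + zcornerSq Q X (x + Pi.single i 1) (j, false) (i, true)
      + zcornerSq Q X (x + Pi.single i 1 + Pi.single j 1) (j, true) (i, true)
      + zcornerSq Q X (x + Pi.single j 1) (i, false) (j, true) := by
  have u₁ := conjTranspose_mul_self_of_mem (hQ (x, i))
  have w₁ := mul_conjTranspose_self_of_mem (hQ (x, i))
  have u₂ := conjTranspose_mul_self_of_mem (hQ (x + Pi.single i 1, j))
  have w₂ := mul_conjTranspose_self_of_mem (hQ (x + Pi.single i 1, j))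
  have hB₂ : Q (x + Pi.single i 1, j) * (Q (x + Pi.single j 1, i))ᴴ ∈ Matrix.unitaryGroup n ℂ :=
    Submonoid.mul_mem _ (hQ _) (conjTranspose_mem_unitaryGroup (hQ _))
  have hB₃ : (Q (x, j))ᴴ ∈ Matrix.unitaryGroup n ℂ := conjTranspose_mem_unitaryGroup (hQ _)
  have hB₄ : (1 : Matrix n n ℂ) ∈ Matrix.unitaryGroup n ℂ := Submonoid.one_mem _
  have spl := word2_le_cornerSq (X (x, i)) (Q (x, i)) (X (x + Pi.single i 1, j))
    (Q (x + Pi.single i 1, j) * (Q (x + Pi.single j 1, i))ᴴ) (-X (x + Pi.single j 1, i))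
    (Q (x, j))ᴴ (-X (x, j)) 1 (hQ _) hB₂ hB₃ hB₄
  rw [corner_bf _ _ _ u₁ w₁, corner_bb _ _ _ _ u₂ w₂, corner_fb, corner_ff] at spl
  rw [zplaqHess]
  simp only [zcornerSq, zendVec_false, zendVec_add_true, zendVec_add_add_true]
  linarith [spl]

/-- **Two-sidedness on `ℤ^d`**: also `-zplaqHess` is bounded by the same four corners
(SPL with the first link negated). -/
theorem neg_zplaqHess_le_corners (Q X : LGConfig d (Matrix n n ℂ))
    (hQ : ∀ e, Q e ∈ Matrix.unitaryGroup n ℂ) (x : Site d) (i j : Fin d) :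
    -zplaqHess Q X x i j ≤
      zcornerSq Q X x (i, false) (j, false)
      + zcornerSq Q X (x + Pi.single i 1) (j, false) (i, true)
      + zcornerSq Q X (x + Pi.single i 1 + Pi.single j 1) (j, true) (i, true)
      + zcornerSq Q X (x + Pi.single j 1) (i, false) (j, true) := by
  have u₁ := conjTranspose_mul_self_of_mem (hQ (x, i))
  have w₁ := mul_conjTranspose_self_of_mem (hQ (x, i))
  have u₂ := conjTranspose_mul_self_of_mem (hQ (x + Pi.single i 1, j))
  have w₂ := mul_conjTranspose_self_of_mem (hQ (x + Pi.single i 1, j))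
  have hB₂ : Q (x + Pi.single i 1, j) * (Q (x + Pi.single j 1, i))ᴴ ∈ Matrix.unitaryGroup n ℂ :=
    Submonoid.mul_mem _ (hQ _) (conjTranspose_mem_unitaryGroup (hQ _))
  have hB₃ : (Q (x, j))ᴴ ∈ Matrix.unitaryGroup n ℂ := conjTranspose_mem_unitaryGroup (hQ _)
  have hB₄ : (1 : Matrix n n ℂ) ∈ Matrix.unitaryGroup n ℂ := Submonoid.one_mem _
  have spl := word2_le_cornerSq (X (x, i)) (-Q (x, i)) (X (x + Pi.single i 1, j))
    (Q (x + Pi.single i 1, j) * (Q (x + Pi.single j 1, i))ᴴ) (-X (x + Pi.single j 1, i))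
    (Q (x, j))ᴴ (-X (x, j)) 1 (neg_mem_unitaryGroup (hQ _)) hB₂ hB₃ hB₄
  rw [word2_neg_left, conjTranspose_neg, Matrix.neg_mul, neg_mul_neg,
    corner_bf _ _ _ u₁ w₁, corner_bb _ _ _ _ u₂ w₂, corner_fb, corner_ff] at spl
  rw [zplaqHess]
  simp only [zcornerSq, zendVec_false, zendVec_add_true, zendVec_add_add_true]
  linarith [spl]

/-! ## The regional Hessian form and its vertex set -/

/-- The regional Hessian form of the finite edge set `E`: the sum of the plaquette Hessian forms
over all plaquettes of `ℤ^d` touching `E` (`plaquettesTouching E`, the plaquettes of the DLR kernel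
of `E`). For `X` supported on `E` this is the full (finitely supported) lattice sum. -/
def regionHess (Q X : LGConfig d (Matrix n n ℂ)) (E : Finset (ZdEdge d)) : ℝ :=
  ∑ p ∈ plaquettesTouching E, zplaqHess Q X p.1 p.2.1.1 p.2.1.2

/-- `Σ_{e ∈ E} ‖X_e‖²`. -/
def regionNormSq (X : LGConfig d (Matrix n n ℂ)) (E : Finset (ZdEdge d)) : ℝ :=
  ∑ e ∈ E, frobSq (X e)

/-- The four vertices `x, x+eᵢ, x+eⱼ, x+eᵢ+eⱼ` of a plaquette of `ℤ^d`. -/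
def plaqVerts (p : ZdPlaquette d) : Finset (Site d) :=
  {p.1, p.1 + Pi.single p.2.1.1 1, p.1 + Pi.single p.2.1.2 1,
    p.1 + Pi.single p.2.1.1 1 + Pi.single p.2.1.2 1}

/-- The (finite) set of vertices of the plaquettes touching `E`. -/
def regionVerts (E : Finset (ZdEdge d)) : Finset (Site d) :=
  (plaquettesTouching E).biUnion plaqVerts

/-- **Step B on `ℤ^d` (one corner type).** Re-index a sum over the plaquettes touching `E` by the
corner vertex `p.1 + off(p.2)`: the map `p ↦ (p.1 + off p.2, p.2)` is injective and lands in
`regionVerts E × (direction pairs)`, so for a nonnegative `g` the plaquette sum is at most the sum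
over all (vertex, pair). -/
theorem sum_corners_le_verts (E : Finset (ZdEdge d))
    (off : {q : Fin d × Fin d // q.1 < q.2} → Site d)
    (hoff : ∀ p : ZdPlaquette d, p.1 + off p.2 ∈ plaqVerts p)
    (g : Site d → {q : Fin d × Fin d // q.1 < q.2} → ℝ) (hg : ∀ v q, 0 ≤ g v q) :
    ∑ p ∈ plaquettesTouching E, g (p.1 + off p.2) p.2 ≤
      ∑ v ∈ regionVerts E, ∑ q : {q : Fin d × Fin d // q.1 < q.2}, g v q := by
  classical
  set φ : ZdPlaquette d → Site d × {q : Fin d × Fin d // q.1 < q.2} :=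
    fun p => (p.1 + off p.2, p.2) with hφ
  have hinj : Set.InjOn φ ↑(plaquettesTouching E) := by
    intro p _ p' _ h
    simp only [hφ, Prod.mk.injEq] at h
    obtain ⟨h1, h2⟩ := h
    have : p.1 = p'.1 := by
      rw [h2] at h1
      exact add_right_cancel h1
    exact Prod.ext this h2
  have hsum : ∑ p ∈ plaquettesTouching E, g (p.1 + off p.2) p.2 =
      ∑ y ∈ (plaquettesTouching E).image φ, g y.1 y.2 := by
    rw [Finset.sum_image hinj]
  rw [hsum]
  have hsub : (plaquettesTouching E).image φ ⊆ regionVerts E ×ˢ Finset.univ := by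
    intro y hy
    obtain ⟨p, hp, rfl⟩ := Finset.mem_image.1 hy
    refine Finset.mem_product.2 ⟨?_, Finset.mem_univ _⟩
    exact Finset.mem_biUnion.2 ⟨p, hp, hoff p⟩
  calc ∑ y ∈ (plaquettesTouching E).image φ, g y.1 y.2
      ≤ ∑ y ∈ regionVerts E ×ˢ (Finset.univ : Finset {q : Fin d × Fin d // q.1 < q.2}), g y.1 y.2 :=
        Finset.sum_le_sum_of_subset_of_nonneg hsub fun y _ _ => hg y.1 y.2
    _ = ∑ v ∈ regionVerts E, ∑ q : {q : Fin d × Fin d // q.1 < q.2}, g v q := by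
        rw [Finset.sum_product]

/-! ## Step C: at a vertex, all direction pairs -/

omit [DecidableEq n] in
/-- At one site, the corner terms of all direction pairs `i < j` are bounded by
`2d Σ_a ‖X̂_a(v)‖²` (`sum_orthPairs_le`). -/
theorem sum_zsiteCorner_le (Q X : LGConfig d (Matrix n n ℂ)) (v : Site d) :
    ∑ q : {q : Fin d × Fin d // q.1 < q.2}, zsiteCorner Q X v q.1.1 q.1.2
      ≤ 2 * d * ∑ a : Fin d × Bool, frobSq (zendVec Q X v a) := by
  have sy : ∀ a b, zcornerSq Q X v a b = zcornerSq Q X v b a := fun a b => by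
    rw [zcornerSq, zcornerSq, ← frobSq_neg, neg_sub]
  have hconv : ∑ q : {q : Fin d × Fin d // q.1 < q.2}, zsiteCorner Q X v q.1.1 q.1.2
      = ∑ i : Fin d, ∑ j : Fin d, (if i < j then zsiteCorner Q X v i j else 0) := by
    rw [← Finset.sum_subtype (Finset.univ.filter fun p : Fin d × Fin d => p.1 < p.2) (by simp)
      (fun p : Fin d × Fin d => zsiteCorner Q X v p.1 p.2), Finset.sum_filter, Fintype.sum_prod_type]
  rw [hconv]
  refine le_trans (le_of_eq ?_) (sum_orthPairs_le d (zendVec Q X v))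
  refine Finset.sum_congr rfl fun i _ => Finset.sum_congr rfl fun j _ => ?_
  split_ifs with hij
  · rw [zsiteCorner, sy (j, false) (i, true), sy (j, true) (i, true)]
    simp only [Fintype.sum_bool, zcornerSq]
    ring
  · rfl

/-! ## Step D: every edge has two ends, and `X` vanishes off `E` -/

omit [DecidableEq n] in
/-- A sum of `‖X_e‖²` over any finite edge set is at most the sum over `E` when `X` vanishes off `E`. -/
theorem sum_frobSq_le_of_vanish (X : LGConfig d (Matrix n n ℂ)) (E S : Finset (ZdEdge d))
    (hX : ∀ e ∉ E, X e = 0) : ∑ e ∈ S, frobSq (X e) ≤ ∑ e ∈ E, frobSq (X e) := by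
  classical
  rw [← Finset.sum_filter_add_sum_filter_not S (fun e => e ∈ E)]
  have h0 : ∑ e ∈ S.filter (fun e => ¬ e ∈ E), frobSq (X e) = 0 := by
    refine Finset.sum_eq_zero fun e he => ?_
    rw [hX e (Finset.mem_filter.1 he).2]
    simp [frobSq]
  rw [h0, add_zero]
  exact Finset.sum_le_sum_of_subset_of_nonneg (fun e he => (Finset.mem_filter.1 he).2)
    fun e _ _ => frobSq_nonneg _

/-- **Step D on `ℤ^d`**: over any finite vertex set `V`, `Σ_{v∈V} Σ_a ‖X̂_a(v)‖² ≤ 2 Σ_{e∈E} ‖X_e‖²`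
for unitary links and `X` vanishing off `E` (each edge is seen at most once from each end). -/
theorem sum_zendVec_sq_le (Q X : LGConfig d (Matrix n n ℂ))
    (hQ : ∀ e, Q e ∈ Matrix.unitaryGroup n ℂ) (E : Finset (ZdEdge d)) (hX : ∀ e ∉ E, X e = 0)
    (V : Finset (Site d)) :
    ∑ v ∈ V, ∑ a : Fin d × Bool, frobSq (zendVec Q X v a) ≤ 2 * regionNormSq X E := by
  classical
  have hpt : ∀ v : Site d, ∑ a : Fin d × Bool, frobSq (zendVec Q X v a)
      = ∑ i : Fin d, frobSq (X (v, i)) + ∑ i : Fin d, frobSq (X (v - Pi.single i 1, i)) := by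
    intro v
    rw [Fintype.sum_prod_type, ← Finset.sum_add_distrib]
    refine Finset.sum_congr rfl fun i _ => ?_
    rw [Fintype.sum_bool, zendVec_true, zendVec_false, frobSq_neg,
      frobSq_conj' _ _ (mul_conjTranspose_self_of_mem (hQ _)), add_comm]
  simp_rw [hpt, Finset.sum_add_distrib]
  -- forward ends: the edges `(v, i)`, `v ∈ V`
  have h1 : ∑ v ∈ V, ∑ i : Fin d, frobSq (X (v, i)) ≤ regionNormSq X E := by
    rw [← Finset.sum_product (s := V) (t := (Finset.univ : Finset (Fin d)))
      (f := fun e : ZdEdge d => frobSq (X e))]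
    exact sum_frobSq_le_of_vanish X E _ hX
  -- backward ends: the edges `(v - eᵢ, i)`, `v ∈ V`, an injective image
  have h2 : ∑ v ∈ V, ∑ i : Fin d, frobSq (X (v - Pi.single i 1, i)) ≤ regionNormSq X E := by
    set ψ : ZdEdge d → ZdEdge d := fun e => (e.1 - Pi.single e.2 1, e.2) with hψ
    have hinj : Set.InjOn ψ ↑(V ×ˢ (Finset.univ : Finset (Fin d))) := by
      intro e _ e' _ h
      simp only [hψ, Prod.mk.injEq] at h
      obtain ⟨h1, h2⟩ := h
      have : e.1 = e'.1 := by
        rw [h2] at h1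
        exact sub_left_injective h1
      exact Prod.ext this h2
    have : ∑ v ∈ V, ∑ i : Fin d, frobSq (X (v - Pi.single i 1, i))
        = ∑ e ∈ (V ×ˢ (Finset.univ : Finset (Fin d))).image ψ, frobSq (X e) := by
      rw [Finset.sum_image hinj, Finset.sum_product]
    rw [this]
    exact sum_frobSq_le_of_vanish X E _ hX
  unfold regionNormSq at h1 h2 ⊢
  linarith

/-! ## Steps A–D assembled -/

/-- **Steps A–D on `ℤ^d`, for any plaquette functional bounded by its corners.** If `P x i j` is
at most the four corner terms of the plaquette `(x; i, j)`, then its sum over the plaquettes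
touching `E` is at most `4d Σ_{e∈E} ‖X_e‖²` (unitary links, `X` vanishing off `E`). -/
theorem regionSum_le_four_d_of_le_corners (Q X : LGConfig d (Matrix n n ℂ))
    (hQ : ∀ e, Q e ∈ Matrix.unitaryGroup n ℂ) (E : Finset (ZdEdge d)) (hX : ∀ e ∉ E, X e = 0)
    (P : Site d → Fin d → Fin d → ℝ)
    (hP : ∀ x i j, P x i j ≤
      zcornerSq Q X x (i, false) (j, false)
      + zcornerSq Q X (x + Pi.single i 1) (j, false) (i, true)
      + zcornerSq Q X (x + Pi.single i 1 + Pi.single j 1) (j, true) (i, true)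
      + zcornerSq Q X (x + Pi.single j 1) (i, false) (j, true)) :
    ∑ p ∈ plaquettesTouching E, P p.1 p.2.1.1 p.2.1.2 ≤ 4 * d * regionNormSq X E := by
  classical
  -- Step A summed
  have hA : ∑ p ∈ plaquettesTouching E, P p.1 p.2.1.1 p.2.1.2 ≤
      ∑ p ∈ plaquettesTouching E, zcornerSq Q X p.1 (p.2.1.1, false) (p.2.1.2, false)
      + ∑ p ∈ plaquettesTouching E,
          zcornerSq Q X (p.1 + Pi.single p.2.1.1 1) (p.2.1.2, false) (p.2.1.1, true)
      + ∑ p ∈ plaquettesTouching E,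
          zcornerSq Q X (p.1 + Pi.single p.2.1.1 1 + Pi.single p.2.1.2 1)
            (p.2.1.2, true) (p.2.1.1, true)
      + ∑ p ∈ plaquettesTouching E,
          zcornerSq Q X (p.1 + Pi.single p.2.1.2 1) (p.2.1.1, false) (p.2.1.2, true) := by
    rw [← Finset.sum_add_distrib, ← Finset.sum_add_distrib, ← Finset.sum_add_distrib]
    exact Finset.sum_le_sum fun p _ => hP p.1 p.2.1.1 p.2.1.2
  -- Step B: each corner type re-indexed by its vertex
  have hB₁ := sum_corners_le_verts E (fun _ => (0 : Site d))
    (fun p => by simp [plaqVerts])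
    (fun v q => zcornerSq Q X v (q.1.1, false) (q.1.2, false)) (fun v q => zcornerSq_nonneg _ _ _ _ _)
  have hB₂ := sum_corners_le_verts E (fun q => Pi.single q.1.1 1)
    (fun p => by simp [plaqVerts])
    (fun v q => zcornerSq Q X v (q.1.2, false) (q.1.1, true)) (fun v q => zcornerSq_nonneg _ _ _ _ _)
  have hB₃ := sum_corners_le_verts E (fun q => Pi.single q.1.1 1 + Pi.single q.1.2 1)
    (fun p => by simp [plaqVerts, add_assoc])
    (fun v q => zcornerSq Q X v (q.1.2, true) (q.1.1, true)) (fun v q => zcornerSq_nonneg _ _ _ _ _)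
  have hB₄ := sum_corners_le_verts E (fun q => Pi.single q.1.2 1)
    (fun p => by simp [plaqVerts])
    (fun v q => zcornerSq Q X v (q.1.1, false) (q.1.2, true)) (fun v q => zcornerSq_nonneg _ _ _ _ _)
  simp only [add_zero] at hB₁
  simp only [← add_assoc] at hB₃
  -- Steps C and D
  have hC : ∑ v ∈ regionVerts E, ∑ q : {q : Fin d × Fin d // q.1 < q.2},
      zsiteCorner Q X v q.1.1 q.1.2 ≤ 2 * d * (2 * regionNormSq X E) := by
    calc ∑ v ∈ regionVerts E, ∑ q : {q : Fin d × Fin d // q.1 < q.2}, zsiteCorner Q X v q.1.1 q.1.2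
        ≤ ∑ v ∈ regionVerts E, 2 * d * ∑ a : Fin d × Bool, frobSq (zendVec Q X v a) :=
          Finset.sum_le_sum fun v _ => sum_zsiteCorner_le Q X v
      _ = 2 * d * ∑ v ∈ regionVerts E, ∑ a : Fin d × Bool, frobSq (zendVec Q X v a) := by
          rw [Finset.mul_sum]
      _ ≤ 2 * d * (2 * regionNormSq X E) :=
          mul_le_mul_of_nonneg_left (sum_zendVec_sq_le Q X hQ E hX _) (by positivity)
  have hsite : ∑ v ∈ regionVerts E, ∑ q : {q : Fin d × Fin d // q.1 < q.2},
      zsiteCorner Q X v q.1.1 q.1.2 =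
      ∑ v ∈ regionVerts E, ∑ q : {q : Fin d × Fin d // q.1 < q.2},
          zcornerSq Q X v (q.1.1, false) (q.1.2, false)
      + ∑ v ∈ regionVerts E, ∑ q : {q : Fin d × Fin d // q.1 < q.2},
          zcornerSq Q X v (q.1.2, false) (q.1.1, true)
      + ∑ v ∈ regionVerts E, ∑ q : {q : Fin d × Fin d // q.1 < q.2},
          zcornerSq Q X v (q.1.2, true) (q.1.1, true)
      + ∑ v ∈ regionVerts E, ∑ q : {q : Fin d × Fin d // q.1 < q.2},
          zcornerSq Q X v (q.1.1, false) (q.1.2, true) := by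
    simp only [zsiteCorner, Finset.sum_add_distrib]
  linarith [hA, hB₁, hB₂, hB₃, hB₄, hC, hsite]

/-- **Theorem C on `ℤ^d`, regional form.** For unitary links `Q` on `ℤ^d` and a perturbation `X`
vanishing off the finite edge set `E`: `Σ_{p ∩ E ≠ ∅} plaqHess_p(Q,X) ≤ 4d Σ_{e∈E} ‖X_e‖²`. -/
theorem regionHess_le_four_d (Q X : LGConfig d (Matrix n n ℂ))
    (hQ : ∀ e, Q e ∈ Matrix.unitaryGroup n ℂ) (E : Finset (ZdEdge d)) (hX : ∀ e ∉ E, X e = 0) :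
    regionHess Q X E ≤ 4 * d * regionNormSq X E :=
  regionSum_le_four_d_of_le_corners Q X hQ E hX _ (zplaqHess_le_corners Q X hQ)

/-- Two-sided: `-regionHess ≤ 4d Σ_{e∈E} ‖X_e‖²`. -/
theorem neg_regionHess_le_four_d (Q X : LGConfig d (Matrix n n ℂ))
    (hQ : ∀ e, Q e ∈ Matrix.unitaryGroup n ℂ) (E : Finset (ZdEdge d)) (hX : ∀ e ∉ E, X e = 0) :
    -regionHess Q X E ≤ 4 * d * regionNormSq X E := by
  have h := regionSum_le_four_d_of_le_corners Q X hQ E hX _ (neg_zplaqHess_le_corners Q X hQ)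
  refine le_trans (le_of_eq ?_) h
  rw [regionHess, ← Finset.sum_neg_distrib]

/-- `|regionHess| ≤ 4d Σ_{e∈E} ‖X_e‖²`. -/
theorem abs_regionHess_le_four_d (Q X : LGConfig d (Matrix n n ℂ))
    (hQ : ∀ e, Q e ∈ Matrix.unitaryGroup n ℂ) (E : Finset (ZdEdge d)) (hX : ∀ e ∉ E, X e = 0) :
    |regionHess Q X E| ≤ 4 * d * regionNormSq X E :=
  abs_le.mpr ⟨by linarith [neg_regionHess_le_four_d Q X hQ E hX], regionHess_le_four_d Q X hQ E hX⟩

end Summit.Ventures.YMGap.HessianSharp
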